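import Summits.CriticalPhenomena.PercolationContinuityZ3.Theorems.PercTreeValueEquilateralAntiFactorisationFlowCertificate
import HarnessLib

/-!
# Line `Sketch` — skeleton (lead c2) for the crux `EquilateralAntiFactorisation`
(stmt-CriticalPhenomena-7800, route PercTreeValue)

Slim form of `Cruxes/EquilateralAntiFactorisation/Lines/Sketch.lean`: every piece of the line except
the hard stub S7 is a LANDED theorem, so the skeleton imports them instead of re-proving them.

* S1–S6 (`stub_halfsum`, `stub_pivotalOpen`, `stub_pivotalContinuous`, `stub_pos`, `stub_boxLimit`,
  `stub_anchor`): `Theorems/PercTreeValueEquilateralAntiFactorisation{Halfsum,PivotalOpen,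
  PivotalContinuous,Pos,BoxLimit,Anchor}.lean` (p104341, p105733, p104875, p105735, p104874, p105734);
* flow objects `mu, ptA, ptB, evA, evB, evC, evT, pivInt, pivCount, flowIntegrand, boxLogRatio,
  infLogRatio`: `…FlowDefs.lean` (p107554);
* Russo flow identity, box exhaustion, deficit reading: `…Flow.lean` (p109290);
* certificate `window_iff_EquilateralAntiFactorisation`, `EquilateralAntiFactorisation_of_window`,
  tail localisation `window_shrink`: `…FlowCertificate.lean` (p111224).

The ONLY `sorry` is `stub_window` (S7); the composition `EquilateralAntiFactorisation_of` concludes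
the crux by name from it. By the certificate S7 is EQUIVALENT to the crux, and the crux implies the
summit conjunct (`assemblyViaThreePoint_proof connectionPatternFactorisation_proof`).
-/

noncomputable section

namespace Summit.CriticalPhenomena.PercolationContinuityZ3.Cruxes.EquilateralAntiFactorisation.Sketch

open MeasureTheory Filter Topology intervalIntegral
open Literature.Probability.Percolation Literature.Probability.LatticeModels
open Summit.CriticalPhenomena.PercolationContinuityZ3.Theorems.EquilateralAntiFactorisation.Flow
open Summit.CriticalPhenomena.PercolationContinuityZ3.Theses.PercTreeValue (EquilateralAntiFactorisation)

/-- **S7 `stub_window` (the hard stub, lead-held; box form).** There are a window `ε₀ > 0` and a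
margin `δ > 0` such that for all large `r` and all large boxes `Λ_n` the Russo flow of the box
log-ratio `F_{n,r} = 2 log P(T) − log P(A) − log P(B) − log P(C)` across `[p_c, p_c + ε₀]` is
`≤ −δ`: `∫_{p_c}^{p_c+ε₀} flowIntegrand n r q dq ≤ −δ`. Kernel-checked to be EQUIVALENT to the crux
(`window_iff_EquilateralAntiFactorisation`). -/
theorem stub_window :
    ∃ ε₀ : ℝ, 0 < ε₀ ∧ (criticalProbI 3 : ℝ) + ε₀ < 1 ∧ ∃ δ : ℝ, 0 < δ ∧ ∃ r₀ : ℕ, ∀ r : ℕ, r₀ ≤ r →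
      ∃ n₀ : ℕ, ∀ n : ℕ, n₀ ≤ n →
        ∫ q in (criticalProbI 3 : ℝ)..((criticalProbI 3 : ℝ) + ε₀), flowIntegrand n r q ≤ -δ := by
  sorry

/-- **Composition.** The line closes the crux from its single open stub: window deficit ⟹
`log R_r(p_c)² ≥ δ/2` eventually (box exhaustion + anchor) ⟹ `EquilateralAntiFactorisation`. -/
theorem EquilateralAntiFactorisation_of : EquilateralAntiFactorisation :=
  EquilateralAntiFactorisation_of_window stub_window

end Summit.CriticalPhenomena.PercolationContinuityZ3.Cruxes.EquilateralAntiFactorisation.Sketch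

end
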